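import Summits.Ventures.PercRepro.C041StarBounds

/-!
# STAR BOUNDS II — the two-leaf refinements `4A ≤ P₁` and `(3/2)(1 − A)² ≤ P₁(P₂ − 1)` (mine-3, gen 64; C-041.md §21 (ay))

For a star `a : Fin m → ℝ` with `m ≥ 2` leaves in `[0, 1]` (`A = ∏ a i`, `B = ∏ (1 − a i)`, `P₁ = ∏ (1 + a i ^ 2)`,
`P₂ = ∏ (1 + (1 − a i) ^ 2)`): `4 A ≤ P₁` (from `2 a ≤ 1 + a ^ 2` per leaf and `2 ^ m ≥ 4`), its mirror `4 B ≤ P₂`,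
and the sharpened (R′): `(3/2)·(1 − A) ² ≤ P₁·(P₂ − 1)` (the constant of (R′) is 1 and is attained only by one-leaf stars;
for `m ≥ 2` the sharp constant is ≈ 1.555, at the two-leaf star (0.55, 0.55)); by induction on the leaves from the two-leaf
case.  These are the lower bounds of the LOWER-FRONTIER REDUCTION of the last seed: `θ_△(v 1, ·)` is affine in `(P₁, P₂)`
with cone-valued gradients, so the seed for every star follows from the seed on the lower frontier of the region these
inequalities cut out.
-/

namespace PercRepro

namespace TreeClosure

open Finset

/-- `4 A ≤ P₁` for a star with at least two leaves. -/
theorem four_mul_prod_le_prod_one_add_sq {m : ℕ} (a : Fin (m + 2) → ℝ) (ha : ∀ i, 0 ≤ a i ∧ a i ≤ 1) :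
    4 * ∏ i, a i ≤ ∏ i, (1 + a i ^ 2) := by
  have h1 : ∏ i, (2 * a i) ≤ ∏ i, (1 + a i ^ 2) :=
    Finset.prod_le_prod (fun i _ => by linarith [(ha i).1]) (fun i _ => by nlinarith [sq_nonneg (1 - a i)])
  rw [Finset.prod_mul_distrib, Finset.prod_const, Finset.card_univ, Fintype.card_fin] at h1
  have h4 : (4 : ℝ) ≤ 2 ^ (m + 2) := by
    calc (4 : ℝ) = 2 ^ 2 := by norm_num
      _ ≤ 2 ^ (m + 2) := pow_le_pow_right₀ (by norm_num) (by omega)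
  have hA : 0 ≤ ∏ i, a i := Finset.prod_nonneg (fun i _ => (ha i).1)
  nlinarith [mul_le_mul_of_nonneg_right h4 hA]

/-- `4 B ≤ P₂` for a star with at least two leaves (the mirror). -/
theorem four_mul_prod_one_sub_le_prod {m : ℕ} (a : Fin (m + 2) → ℝ) (ha : ∀ i, 0 ≤ a i ∧ a i ≤ 1) :
    4 * ∏ i, (1 - a i) ≤ ∏ i, (1 + (1 - a i) ^ 2) :=
  four_mul_prod_le_prod_one_add_sq (fun i => 1 - a i) (fun i => ⟨by linarith [(ha i).2], by linarith [(ha i).1]⟩)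

/-- The two-leaf case of the sharpened (R′): `(3/2)(1 − s t)² ≤ (1 + s²)(1 + t²)((1 + (1 − s)²)(1 + (1 − t)²) − 1)`. -/
theorem two_leaf_sharp_R (s t : ℝ) (hs : 0 ≤ s ∧ s ≤ 1) (ht : 0 ≤ t ∧ t ≤ 1) :
    3 / 2 * (1 - s * t) ^ 2 ≤ (1 + s ^ 2) * (1 + t ^ 2) * ((1 + (1 - s) ^ 2) * (1 + (1 - t) ^ 2) - 1) := by
  obtain ⟨hs0, hs1⟩ := hs; obtain ⟨ht0, ht1⟩ := ht
  nlinarith [mul_nonneg hs0 ht0, mul_nonneg (sub_nonneg.2 hs1) (sub_nonneg.2 ht1), mul_nonneg hs0 (sub_nonneg.2 ht1),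
    mul_nonneg ht0 (sub_nonneg.2 hs1), sq_nonneg (s - t), sq_nonneg (s + t - 1), mul_nonneg (mul_nonneg hs0 ht0) (sq_nonneg (s - t)),
    mul_nonneg (mul_nonneg (sub_nonneg.2 hs1) (sub_nonneg.2 ht1)) (sq_nonneg (s - t)),
    mul_nonneg (mul_nonneg hs0 ht0) (mul_nonneg (sub_nonneg.2 hs1) (sub_nonneg.2 ht1)),
    mul_nonneg (mul_nonneg hs0 ht0) (sq_nonneg (s + t - 1)), mul_nonneg (mul_nonneg (sub_nonneg.2 hs1) (sub_nonneg.2 ht1)) (sq_nonneg (s + t - 1)),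
    sq_nonneg (s * t - 1 / 3), sq_nonneg (s * t - (1 - s) * (1 - t))]

/-- The inductive step of the sharpened (R′): a star with `P₁(P₂ − 1) ≥ (3/2)(1 − A)²`, `4A ≤ P₁`, `1 ≤ P₁`, `A ∈ [0, 1]`
gains a leaf `x ∈ [0, 1]`. -/
theorem sharp_R_step (P1 P2 A x : ℝ) (hA0 : 0 ≤ A) (hA1 : A ≤ 1) (hx0 : 0 ≤ x) (hx1 : x ≤ 1) (hP1 : 1 ≤ P1)
    (h4 : 4 * A ≤ P1) (hK : 3 / 2 * (1 - A) ^ 2 ≤ P1 * (P2 - 1)) :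
    3 / 2 * (1 - A * x) ^ 2 ≤ P1 * (1 + x ^ 2) * (P2 * (1 + (1 - x) ^ 2) - 1) := by
  have hu0 : 0 ≤ 1 - A := by linarith
  have hx0' : 0 ≤ 1 - x := by linarith
  have hkey : P1 * (1 + x ^ 2) * (P2 * (1 + (1 - x) ^ 2) - 1)
      = (1 + x ^ 2) * (1 + (1 - x) ^ 2) * (P1 * (P2 - 1)) + (1 + x ^ 2) * (1 - x) ^ 2 * P1 := by ring
  rw [hkey]
  have h1 : (1 + x ^ 2) * (1 + (1 - x) ^ 2) * (3 / 2 * (1 - A) ^ 2) ≤ (1 + x ^ 2) * (1 + (1 - x) ^ 2) * (P1 * (P2 - 1)) :=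
    mul_le_mul_of_nonneg_left hK (by positivity)
  rcases le_or_gt A (2 / 5) with hA | hA
  · -- `A ≤ 2/5`: `1 − A ≥ 3/5` and `P₁ ≥ 1` suffice
    nlinarith [mul_nonneg (sq_nonneg (1 - x)) (sub_nonneg.2 hP1), mul_nonneg (mul_nonneg hu0 hu0) (mul_nonneg (sq_nonneg x) (sq_nonneg (1 - x))),
      sq_nonneg ((1 - A) - x * (1 - x)), sq_nonneg (1 - x), mul_nonneg hu0 (sub_nonneg.2 hA),
      mul_nonneg (sq_nonneg (1 - x)) (mul_nonneg hu0 (sub_nonneg.2 hA)), mul_nonneg (mul_nonneg hx0 hx0') (mul_nonneg hu0 (sub_nonneg.2 hA)),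
      sq_nonneg (2 * (1 - A) - x * (1 - x) - (1 - x) ^ 2), mul_nonneg (sq_nonneg (1 - x)) (sq_nonneg (1 - A - 1))]
  · -- `A > 2/5`: `P₁ ≥ 4A ≥ 8/5` suffices
    nlinarith [mul_nonneg (sq_nonneg (1 - x)) (sub_nonneg.2 h4), mul_nonneg (mul_nonneg hu0 hu0) (mul_nonneg (sq_nonneg x) (sq_nonneg (1 - x))),
      mul_nonneg (sq_nonneg (1 - x)) (sq_nonneg x), sq_nonneg ((1 - A) * (1 + (1 - x) ^ 2) - x * (1 - x)),
      mul_nonneg (sq_nonneg (1 - x)) (sub_nonneg.2 hA.le), mul_nonneg (sq_nonneg (1 - x)) (mul_nonneg hx0 (sub_nonneg.2 hA.le)),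
      mul_nonneg (sq_nonneg (1 - x)) (mul_nonneg (sq_nonneg x) hA0)]

/-- **THE SHARPENED (R′)**: `(3/2)·(1 − A)² ≤ P₁·(P₂ − 1)` for every star with at least two leaves in `[0, 1]`
(by induction on the leaves from the two-leaf case, through `sharp_R_step`). -/
theorem sharp_R {m : ℕ} (a : Fin (m + 2) → ℝ) (ha : ∀ i, 0 ≤ a i ∧ a i ≤ 1) :
    3 / 2 * (1 - ∏ i, a i) ^ 2 ≤ (∏ i, (1 + a i ^ 2)) * (∏ i, (1 + (1 - a i) ^ 2) - 1) := by
  induction m with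
  | zero =>
    have h := two_leaf_sharp_R (a 0) (a 1) (ha 0) (ha 1)
    simpa [Fin.prod_univ_succ] using h
  | succ n ih =>
    have ih' := ih (fun i => a (Fin.castSucc i)) (fun i => ha _)
    have h4 := four_mul_prod_le_prod_one_add_sq (fun i => a (Fin.castSucc i)) (fun i => ha _)
    obtain ⟨hA0, hA1⟩ := prod_unit_mem (fun i : Fin (n + 2) => a (Fin.castSucc i)) (fun i => ha _)
    have hP := one_le_prod_one_add_sq (fun i : Fin (n + 2) => a (Fin.castSucc i))
    obtain ⟨hx0, hx1⟩ := ha (Fin.last (n + 2))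
    rw [Fin.prod_univ_castSucc (fun i => a i), Fin.prod_univ_castSucc (fun i => 1 + a i ^ 2),
      Fin.prod_univ_castSucc (fun i => 1 + (1 - a i) ^ 2)]
    exact sharp_R_step _ _ _ _ hA0 hA1 hx0 hx1 hP h4 ih'

/-- The mirror of `sharp_R`: `(3/2)·(1 − B)² ≤ P₂·(P₁ − 1)` for every star with at least two leaves. -/
theorem sharp_R_mirror {m : ℕ} (a : Fin (m + 2) → ℝ) (ha : ∀ i, 0 ≤ a i ∧ a i ≤ 1) :
    3 / 2 * (1 - ∏ i, (1 - a i)) ^ 2 ≤ (∏ i, (1 + (1 - a i) ^ 2)) * (∏ i, (1 + a i ^ 2) - 1) := by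
  have h := sharp_R (fun i => 1 - a i) (fun i => ⟨by linarith [(ha i).2], by linarith [(ha i).1]⟩)
  simpa only [sub_sub_cancel] using h

/-- `P₁ ^ 2 · B ≤ 1`: per leaf `(1 + b ^ 2) ^ 2 (1 − b) ≤ 1` (the sharper form of `P₁ · B ≤ 1`; the sharp exponent is
`P₁ ^ 2.98 · B ≤ 1`). -/
theorem prod_one_add_sq_sq_mul_prod_one_sub_le_one {m : ℕ} (a : Fin m → ℝ) (ha : ∀ i, 0 ≤ a i ∧ a i ≤ 1) :
    (∏ i, (1 + a i ^ 2)) ^ 2 * ∏ i, (1 - a i) ≤ 1 := by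
  rw [← Finset.prod_pow, ← Finset.prod_mul_distrib]
  refine Finset.prod_le_one (fun i _ => ?_) (fun i _ => ?_)
  · obtain ⟨h0, h1⟩ := ha i
    exact mul_nonneg (by positivity) (by linarith)
  · obtain ⟨h0, h1⟩ := ha i
    nlinarith [mul_nonneg h0 (sq_nonneg (1 - a i)), mul_nonneg (pow_nonneg h0 3) (by nlinarith : (0:ℝ) ≤ 1 - a i + a i ^ 2)]

/-- `P₂ ^ 2 · A ≤ 1` (the mirror). -/
theorem prod_one_add_one_sub_sq_sq_mul_prod_le_one {m : ℕ} (a : Fin m → ℝ) (ha : ∀ i, 0 ≤ a i ∧ a i ≤ 1) :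
    (∏ i, (1 + (1 - a i) ^ 2)) ^ 2 * ∏ i, a i ≤ 1 := by
  have h := prod_one_add_sq_sq_mul_prod_one_sub_le_one (fun i => 1 - a i)
    (fun i => ⟨by linarith [(ha i).2], by linarith [(ha i).1]⟩)
  simpa only [sub_sub_cancel] using h

end TreeClosure

end PercRepro
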